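import Mathlib
import HarnessLib

/-!
# A priori error estimates and R-order `1 + d` for Newton's method under an ω-Lipschitz first derivative
# (Ezquerro–Hernández-Verón 2017, §4.2.2: Lemma 4.13 (iiₙ), (ivₙ) and Theorem 4.15 with proof)

Topic `Literature/Analysis/Calculus`, the sequel of `OmegaLipschitzNewtonSequences.lean` (the scalar
sequences (4.4)–(4.6) of §4.2.1 and, for `h(t) = t^d`, the sequence
`aₙ = aₙ₋₁^{1+d} f(aₙ₋₁)^{1+d}/(1 + d)^d` of §4.2.2 with Lemmas 4.8, 4.12 and 4.14).  Setting (§4.2,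
(Q1)–(Q2) with `h(t) = t^d`, `d ∈ (0, 1]`, p. 139): `a₀ = β ω(η)` satisfies (4.14), `f(t) = 1/(1 − t)`
(4.7), `Δ = a₀ f(a₀)/(1 + d)`, `R = 1/(1 − Δ)`, `γ = a₁/a₀`.  **Lemma 4.13** (p. 139) gives, for
Newton's sequence, the recurrence relations

* (iiₙ) `‖x_{n+1} − xₙ‖ ≤ (aₙ₋₁/(1 + d)) f(aₙ₋₁) ‖xₙ − xₙ₋₁‖` (`n ≥ 1`),
* (ivₙ) `‖x_{n+1} − x₀‖ ≤ ((1 − Δ^{n+1})/(1 − Δ)) ‖x₁ − x₀‖ < R η`,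

and **Theorem 4.15** (p. 140) the a priori error estimates

  `‖x* − xₙ‖ ≤ γ^{((1+d)ⁿ − 1)/d²} Θⁿ η / (1 − γ^{(1+d)ⁿ/d} Θ)`,  `n ≥ 0`,            (4.15)

where `Θ = Δ/γ^{1/d}`, through the chain of its proof: `∏_{i=0}^{j} (aᵢ/(1+d)) f(aᵢ) = Δ Θʲ γ^{(1+d)((1+d)ʲ−1)/d²}`,
`γ^{((1+d)^{n+i}−1)/d²} ≤ γ^{((1+d)ⁿ−1)/d²} γ^{(1+d)ⁿ i/d}`,

  `‖x_{n+m} − xₙ‖ < (1 − (Θγ^{(1+d)ⁿ/d})^m)/(1 − Θγ^{(1+d)ⁿ/d}) Θⁿ η γ^{((1+d)ⁿ−1)/d²}`,      (4.16)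

and finally `‖x* − xₙ‖ ≤ (η/(γ^{1/d²}(1 − Θ))) (γ^{1/d²})^{(1+d)ⁿ}`, i.e. R-order of convergence at
least `1 + d`.

This file types the OPERATOR-FREE content of these statements (imports `Mathlib` + `HarnessLib`):

* §Scalar: from the conclusions of Lemmas 4.12 and 4.14 (b) — `0 ≤ aₙ ≤ a₀ < 1` and
  `aₙ ≤ γ^{((1+d)ⁿ−1)/d} a₀`, proved in `OmegaLipschitzNewtonSequences.lean` and taken here as
  hypotheses — the factor bounds `cₙ := aₙ f(aₙ)/(1 + d) ≤ Δ γ^{((1+d)ⁿ−1)/d}` and `cₙ ≤ Δ`, the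
  product bounds `∏_{i<k} cᵢ ≤ Θ^k γ^{((1+d)^k − 1)/d²}` (the displayed product identity of the printed
  proof, which is in fact an inequality, shifted by one index) and `∏_{i<k} cᵢ ≤ Δ^k`, and the closed
  form `Θ = (1 − a₀)^{1/d}` of `Θ = Δ/γ^{1/d}` (so `0 < Θ < 1`, which the book uses tacitly when it
  divides by `1 − Θ`);
* §Normed: for ANY sequence `x` in a normed group with `‖x₁ − x₀‖ ≤ η` and the ratio recursion (iiₙ)
  `‖x_{n+2} − x_{n+1}‖ ≤ cₙ ‖x_{n+1} − xₙ‖` (`cₙ ≥ 0`): `‖x_{k+1} − x_k‖ ≤ η ∏_{i<k} cᵢ`; under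
  `‖x_{k+1} − x_k‖ ≤ η Δ^k` the bound (ivₙ) `‖x_{n+1} − x₀‖ ≤ η (1 − Δ^{n+1})/(1 − Δ) ≤ η/(1 − Δ)`;
  under the step bound `‖x_{k+1} − x_k‖ ≤ η Θ^k γ^{((1+d)^k−1)/d²}` (`0 < γ ≤ 1`, `0 ≤ Θ < 1`): the
  estimate (4.16), `x` is Cauchy, and for a limit `x*` the estimate (4.15) and its R-order form.

The operator-level Lemma 4.13 / Theorem 4.15 (Newton's sequence satisfies (iiₙ) with these `cₙ`) is
assembled in a sibling file from `CenterLipschitzLocalNewton.lean`'s perturbation lemma.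

## Rendering and deviations

* `d` is a real with `0 < d`; real powers are `Real.rpow`; `γ`, `Δ`, `Θ` are real parameters tied to
  the sequence `a : ℕ → ℝ` by hypothesis equations (`Δ = a₀ (1/(1 − a₀))/(1 + d)`, `Θ γ^{1/d} = Δ`),
  so that this file does not import its sibling; `(1+d)ⁿ` in exponents is `(1 + d) ^ n` with `n : ℕ`.
* (4.16) and (ivₙ) are typed with `≤` (the printed `<` fails for `η = 0`); (4.15) is the limit form of
  (4.16), stated for any limit `x*` of the sequence (`x` is shown to be Cauchy).
* The exponent comparison between (4.16) and (4.15) is Bernoulli's inequality `(1 + d)^i ≥ 1 + i d`;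
  it needs `γ ≤ 1`, which holds since `γ = a₁/a₀ ∈ (0, 1)` (`omegaNewtonSeqPow_ratio` of the sibling)
  and is a hypothesis here.
-/

open Set Filter Topology

namespace Literature.Analysis.Calculus

/-! ## §Scalar: the factors `cₙ = aₙ f(aₙ)/(1 + d)`, their products, and `Θ` -/

section Scalar

variable {d γ Δ Θ : ℝ} {a : ℕ → ℝ}

/-- The factors `cₙ = (aₙ/(1 + d)) f(aₙ) = aₙ (1/(1 − aₙ))/(1 + d)` of Lemma 4.13 (iiₙ) are nonnegative
when `0 ≤ aₙ ≤ a₀ < 1`. [cite: EzquerrofernandezHernandezveron2017, §4.2.2 Lemma 4.12, Lemma 4.13 (iiₙ) (p. 139)] -/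
private theorem oneAux_factor_nonneg (hd : 0 < d) (hn0 : ∀ n, 0 ≤ a n) (hle0 : ∀ n, a n ≤ a 0)
    (ha01 : a 0 < 1) (n : ℕ) : 0 ≤ a n * (1 / (1 - a n)) / (1 + d) := by
  have h1n : 0 < 1 - a n := by linarith [hle0 n]
  exact div_nonneg (mul_nonneg (hn0 n) (div_nonneg zero_le_one h1n.le)) (by linarith)

/-- Factor bound in the proof of Theorem 4.15: if `0 ≤ aₙ ≤ a₀ < 1` (Lemma 4.12) and
`aₙ ≤ γ^{((1+d)ⁿ−1)/d} a₀` (Lemma 4.14 (b)), then, with `Δ = (a₀/(1 + d)) f(a₀)`,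
`0 ≤ (aₙ/(1 + d)) f(aₙ) ≤ Δ γ^{((1+d)ⁿ−1)/d}` (since `f` is increasing, `f(aₙ) ≤ f(a₀)`).
[cite: EzquerrofernandezHernandezveron2017, §4.2.2 Lemma 4.13 (iiₙ), Lemma 4.14 (b), proof of Theorem 4.15 (pp. 139–140)] -/
theorem omegaNewtonErr_factor_le (hd : 0 < d) (hγ0 : 0 ≤ γ) (hn0 : ∀ n, 0 ≤ a n)
    (hle0 : ∀ n, a n ≤ a 0) (ha01 : a 0 < 1)
    (hγ : ∀ n, a n ≤ γ ^ (((1 + d) ^ n - 1) / d) * a 0)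
    (hΔ : Δ = a 0 * (1 / (1 - a 0)) / (1 + d)) (n : ℕ) :
    0 ≤ a n * (1 / (1 - a n)) / (1 + d) ∧
      a n * (1 / (1 - a n)) / (1 + d) ≤ Δ * γ ^ (((1 + d) ^ n - 1) / d) := by
  have hd1 : 0 < 1 + d := by linarith
  have h1n : 0 < 1 - a n := by linarith [hle0 n]
  have h10 : 0 < 1 - a 0 := by linarith
  refine ⟨oneAux_factor_nonneg hd hn0 hle0 ha01 n, ?_⟩
  have hf : 1 / (1 - a n) ≤ 1 / (1 - a 0) :=
    one_div_le_one_div_of_le h10 (by linarith [hle0 n])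
  have hγe : 0 ≤ γ ^ (((1 + d) ^ n - 1) / d) := Real.rpow_nonneg hγ0 _
  rw [hΔ]
  calc a n * (1 / (1 - a n)) / (1 + d)
      ≤ γ ^ (((1 + d) ^ n - 1) / d) * a 0 * (1 / (1 - a 0)) / (1 + d) := by
        apply div_le_div_of_nonneg_right _ hd1.le
        exact mul_le_mul (hγ n) hf (div_nonneg zero_le_one h1n.le) (mul_nonneg hγe (hn0 0))
    _ = a 0 * (1 / (1 - a 0)) / (1 + d) * γ ^ (((1 + d) ^ n - 1) / d) := by ring

/-- The cruder factor bound behind Lemma 4.13 (ivₙ): `(aₙ/(1 + d)) f(aₙ) ≤ (a₀/(1 + d)) f(a₀) = Δ` when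
`0 ≤ aₙ ≤ a₀ < 1` (`{aₙ}` decreasing, `f` increasing).
[cite: EzquerrofernandezHernandezveron2017, §4.2.2 Lemma 4.12, Lemma 4.13 (iiₙ), (ivₙ) (p. 139)] -/
theorem omegaNewtonErr_factor_le_delta (hd : 0 < d) (hn0 : ∀ n, 0 ≤ a n) (hle0 : ∀ n, a n ≤ a 0)
    (ha01 : a 0 < 1) (hΔ : Δ = a 0 * (1 / (1 - a 0)) / (1 + d)) (n : ℕ) :
    a n * (1 / (1 - a n)) / (1 + d) ≤ Δ := by
  have hd1 : 0 < 1 + d := by linarith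
  have h1n : 0 < 1 - a n := by linarith [hle0 n]
  have h10 : 0 < 1 - a 0 := by linarith
  have hf : 1 / (1 - a n) ≤ 1 / (1 - a 0) :=
    one_div_le_one_div_of_le h10 (by linarith [hle0 n])
  rw [hΔ]
  apply div_le_div_of_nonneg_right _ hd1.le
  exact mul_le_mul (hle0 n) hf (div_nonneg zero_le_one h1n.le) (hn0 0)

/-- Product bound in the proof of Theorem 4.15 (the displayed identity
`∏_{i=0}^{j} (aᵢ/(1+d)) f(aᵢ) = Δ Θʲ γ^{(1+d)((1+d)ʲ−1)/d²}`, `Θ = Δ/γ^{1/d}`, is an upper bound; here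
with the index shifted by one): `∏_{i<k} (aᵢ/(1 + d)) f(aᵢ) ≤ Θ^k γ^{((1+d)^k − 1)/d²}` for every `k`,
given `Θ γ^{1/d} = Δ`, `Θ ≥ 0`, `γ > 0`.
[cite: EzquerrofernandezHernandezveron2017, §4.2.2 proof of Theorem 4.15 (p. 140)] -/
theorem omegaNewtonErr_prod_le (hd : 0 < d) (hγ0 : 0 < γ) (hΘ0 : 0 ≤ Θ) (hn0 : ∀ n, 0 ≤ a n)
    (hle0 : ∀ n, a n ≤ a 0) (ha01 : a 0 < 1)
    (hγ : ∀ n, a n ≤ γ ^ (((1 + d) ^ n - 1) / d) * a 0)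
    (hΔ : Δ = a 0 * (1 / (1 - a 0)) / (1 + d)) (hΘ : Θ * γ ^ (1 / d) = Δ) (k : ℕ) :
    ∏ i ∈ Finset.range k, a i * (1 / (1 - a i)) / (1 + d)
      ≤ Θ ^ k * γ ^ (((1 + d) ^ k - 1) / d ^ 2) := by
  induction k with
  | zero => simp
  | succ k ih =>
    rw [Finset.prod_range_succ]
    obtain ⟨hc0, hc⟩ := omegaNewtonErr_factor_le hd hγ0.le hn0 hle0 ha01 hγ hΔ k
    have hT0 : 0 ≤ Θ ^ k * γ ^ (((1 + d) ^ k - 1) / d ^ 2) :=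
      mul_nonneg (pow_nonneg hΘ0 _) (Real.rpow_nonneg hγ0.le _)
    have hdne : d ≠ 0 := hd.ne'
    have hexp : ((1 + d) ^ k - 1) / d ^ 2 + 1 / d + ((1 + d) ^ k - 1) / d =
        ((1 + d) ^ (k + 1) - 1) / d ^ 2 := by
      field_simp
      ring
    calc (∏ i ∈ Finset.range k, a i * (1 / (1 - a i)) / (1 + d)) * (a k * (1 / (1 - a k)) / (1 + d))
        ≤ Θ ^ k * γ ^ (((1 + d) ^ k - 1) / d ^ 2) * (Δ * γ ^ (((1 + d) ^ k - 1) / d)) :=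
          mul_le_mul ih hc hc0 hT0
      _ = Θ ^ (k + 1) * γ ^ (((1 + d) ^ (k + 1) - 1) / d ^ 2) := by
          rw [← hΘ, ← hexp, Real.rpow_add hγ0, Real.rpow_add hγ0, pow_succ]
          ring

/-- Product bound behind Lemma 4.13 (ivₙ): `∏_{i<k} (aᵢ/(1 + d)) f(aᵢ) ≤ Δ^k`.
[cite: EzquerrofernandezHernandezveron2017, §4.2.2 Lemma 4.13 (iiₙ), (ivₙ) (p. 139)] -/
theorem omegaNewtonErr_prod_le_delta (hd : 0 < d) (hn0 : ∀ n, 0 ≤ a n) (hle0 : ∀ n, a n ≤ a 0)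
    (ha01 : a 0 < 1) (hΔ : Δ = a 0 * (1 / (1 - a 0)) / (1 + d)) (k : ℕ) :
    ∏ i ∈ Finset.range k, a i * (1 / (1 - a i)) / (1 + d) ≤ Δ ^ k := by
  calc ∏ i ∈ Finset.range k, a i * (1 / (1 - a i)) / (1 + d) ≤ ∏ _i ∈ Finset.range k, Δ :=
        Finset.prod_le_prod (fun i _ => oneAux_factor_nonneg hd hn0 hle0 ha01 i)
          (fun i _ => omegaNewtonErr_factor_le_delta hd hn0 hle0 ha01 hΔ i)
    _ = Δ ^ k := by rw [Finset.prod_const, Finset.card_range]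

/-- Closed form of `Θ = Δ/γ^{1/d}` (Theorem 4.15): with `γ = a₁/a₀ = a₀^d f(a₀)^{1+d}/(1 + d)^d` and
`Δ = (a₀/(1 + d)) f(a₀)` one has `(1 − a₀)^{1/d} γ^{1/d} = Δ`, i.e. `Θ = (1 − a₀)^{1/d}` — we record
this computation, which the book leaves implicit when it divides by `1 − Θ` at the end of the proof.
[cite: EzquerrofernandezHernandezveron2017, §4.2.2 Lemma 4.14, Theorem 4.15 (pp. 139–140)] -/
theorem omegaNewtonErr_theta_closed_form (hd : 0 < d) (ha0 : 0 ≤ a 0) (ha01 : a 0 < 1)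
    (hγ1 : γ = a 0 ^ d * (1 / (1 - a 0)) ^ (1 + d) / (1 + d) ^ d)
    (hΔ : Δ = a 0 * (1 / (1 - a 0)) / (1 + d)) :
    (1 - a 0) ^ (1 / d) * γ ^ (1 / d) = Δ := by
  have h10 : 0 < 1 - a 0 := by linarith
  have hd1 : 0 < 1 + d := by linarith
  have hf0 : 0 < 1 / (1 - a 0) := div_pos one_pos h10
  have hγ0 : 0 ≤ γ := by
    rw [hγ1]
    exact div_nonneg (mul_nonneg (Real.rpow_nonneg ha0 _) (Real.rpow_nonneg hf0.le _))
      (Real.rpow_nonneg hd1.le _)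
  have hX : 0 ≤ a 0 * (1 / (1 - a 0)) / (1 + d) := div_nonneg (mul_nonneg ha0 hf0.le) hd1.le
  have hkey : (1 - a 0) * γ = (a 0 * (1 / (1 - a 0)) / (1 + d)) ^ d := by
    rw [hγ1, Real.div_rpow (mul_nonneg ha0 hf0.le) hd1.le, Real.mul_rpow ha0 hf0.le,
      Real.rpow_add hf0, Real.rpow_one]
    rw [show (1 - a 0) * (a 0 ^ d * (1 / (1 - a 0) * (1 / (1 - a 0)) ^ d) / (1 + d) ^ d)
        = a 0 ^ d * (1 / (1 - a 0)) ^ d / (1 + d) ^ d * ((1 - a 0) * (1 / (1 - a 0))) by ring,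
      mul_one_div_cancel h10.ne', mul_one]
  rw [← Real.mul_rpow h10.le hγ0, hkey, one_div d, Real.rpow_rpow_inv hX hd.ne', hΔ]

/-- `Θ = (1 − a₀)^{1/d}` lies in `(0, 1)` when `0 < a₀ < 1` and `d > 0` (so `1/(1 − Θ)` in the R-order
estimate of Theorem 4.15 is finite). [cite: EzquerrofernandezHernandezveron2017, §4.2.2 Theorem 4.15 (p. 140)] -/
theorem omegaNewtonErr_theta_mem (hd : 0 < d) (ha0 : 0 < a 0) (ha01 : a 0 < 1) :
    0 < (1 - a 0) ^ (1 / d) ∧ (1 - a 0) ^ (1 / d) < 1 :=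
  ⟨Real.rpow_pos_of_pos (by linarith) _,
    Real.rpow_lt_one (by linarith) (by linarith) (div_pos one_pos hd)⟩

end Scalar

/-! ## §Normed: step bounds, (ivₙ), (4.16), (4.15) and the R-order form for an abstract sequence -/

section Normed

variable {E : Type*} [NormedAddCommGroup E] {x : ℕ → E} {c : ℕ → ℝ} {η d γ Δ Θ : ℝ}

/-- Iterating the ratio recursion of Lemma 4.13 (iiₙ): if `‖x₁ − x₀‖ ≤ η` and
`‖x_{n+2} − x_{n+1}‖ ≤ cₙ ‖x_{n+1} − xₙ‖` with `cₙ ≥ 0`, then `‖x_{k+1} − x_k‖ ≤ η ∏_{i<k} cᵢ`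
(first display of the proof of Theorem 4.15).
[cite: EzquerrofernandezHernandezveron2017, §4.2.2 Lemma 4.13 (iiₙ), proof of Theorem 4.15 (pp. 139–140)] -/
theorem omegaNewtonErr_step_le_prod (hη : ‖x 1 - x 0‖ ≤ η) (hc0 : ∀ n, 0 ≤ c n)
    (hrec : ∀ n, ‖x (n + 2) - x (n + 1)‖ ≤ c n * ‖x (n + 1) - x n‖) (k : ℕ) :
    ‖x (k + 1) - x k‖ ≤ η * ∏ i ∈ Finset.range k, c i := by
  induction k with
  | zero => simpa using hη
  | succ k ih =>
    rw [Finset.prod_range_succ]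
    calc ‖x (k + 1 + 1) - x (k + 1)‖ ≤ c k * ‖x (k + 1) - x k‖ := hrec k
      _ ≤ c k * (η * ∏ i ∈ Finset.range k, c i) := mul_le_mul_of_nonneg_left ih (hc0 k)
      _ = η * ((∏ i ∈ Finset.range k, c i) * c k) := by ring

/-- **Lemma 4.13 (ivₙ)** in scalar form: if `‖x_{k+1} − x_k‖ ≤ η Δ^k` for all `k` (`η ≥ 0`,
`0 ≤ Δ < 1`), then `‖x_{n+1} − x₀‖ ≤ η (1 − Δ^{n+1})/(1 − Δ) ≤ η/(1 − Δ) = R η` (`R = 1/(1 − Δ)`; the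
printed last inequality is strict, which needs `η > 0`).
[cite: EzquerrofernandezHernandezveron2017, §4.2.2 Lemma 4.13 (ivₙ) (p. 139)] -/
theorem omegaNewtonErr_dist_x0_le (hη0 : 0 ≤ η) (hΔ0 : 0 ≤ Δ) (hΔ1 : Δ < 1)
    (hstep : ∀ k, ‖x (k + 1) - x k‖ ≤ η * Δ ^ k) (n : ℕ) :
    ‖x (n + 1) - x 0‖ ≤ η * (1 - Δ ^ (n + 1)) / (1 - Δ) ∧
      η * (1 - Δ ^ (n + 1)) / (1 - Δ) ≤ η / (1 - Δ) := by
  have htel : ∀ m, ‖x m - x 0‖ ≤ ∑ i ∈ Finset.range m, ‖x (i + 1) - x i‖ := by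
    intro m
    induction m with
    | zero => simp
    | succ m ih =>
      rw [Finset.sum_range_succ]
      calc ‖x (m + 1) - x 0‖ = ‖(x (m + 1) - x m) + (x m - x 0)‖ := by rw [sub_add_sub_cancel]
        _ ≤ ‖x (m + 1) - x m‖ + ‖x m - x 0‖ := norm_add_le _ _
        _ ≤ (∑ i ∈ Finset.range m, ‖x (i + 1) - x i‖) + ‖x (m + 1) - x m‖ := by linarith [ih]
  have e : (Δ ^ (n + 1) - 1) / (Δ - 1) = (1 - Δ ^ (n + 1)) / (1 - Δ) := by
    rw [← neg_div_neg_eq, neg_sub, neg_sub]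
  have h1 : 0 < 1 - Δ := by linarith
  constructor
  · calc ‖x (n + 1) - x 0‖ ≤ ∑ i ∈ Finset.range (n + 1), ‖x (i + 1) - x i‖ := htel (n + 1)
      _ ≤ ∑ i ∈ Finset.range (n + 1), η * Δ ^ i := Finset.sum_le_sum fun i _ => hstep i
      _ = η * (1 - Δ ^ (n + 1)) / (1 - Δ) := by
          rw [← Finset.mul_sum, geom_sum_eq hΔ1.ne (n + 1), e, mul_div_assoc]
  · calc η * (1 - Δ ^ (n + 1)) / (1 - Δ) = η * ((1 - Δ ^ (n + 1)) / (1 - Δ)) := mul_div_assoc _ _ _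
      _ ≤ η * (1 / (1 - Δ)) :=
          mul_le_mul_of_nonneg_left
            (div_le_div_of_nonneg_right (by linarith [pow_nonneg hΔ0 (n + 1)]) h1.le) hη0
      _ = η / (1 - Δ) := (div_eq_mul_one_div η (1 - Δ)).symm

/-- The exponent comparison of the proof of Theorem 4.15:
`((1+d)ⁿ − 1)/d² + i (1+d)ⁿ/d ≤ ((1+d)^{n+i} − 1)/d²`, i.e. `(1+d)ⁿ((1+d)^i − 1) ≥ i d (1+d)ⁿ`
(Bernoulli). [cite: EzquerrofernandezHernandezveron2017, §4.2.2 proof of Theorem 4.15 (p. 140)] -/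
private theorem oneAux_exp_le (hd : 0 < d) (n i : ℕ) :
    ((1 + d) ^ n - 1) / d ^ 2 + (i : ℝ) * ((1 + d) ^ n / d) ≤ ((1 + d) ^ (n + i) - 1) / d ^ 2 := by
  have hd2 : 0 < d ^ 2 := by positivity
  have hdn : 0 ≤ (1 + d) ^ n := pow_nonneg (by linarith) n
  have hB : 1 + (i : ℝ) * d ≤ (1 + d) ^ i := one_add_mul_le_pow (by linarith) i
  have key : (i : ℝ) * d * (1 + d) ^ n ≤ (1 + d) ^ n * (1 + d) ^ i - (1 + d) ^ n := by
    have := mul_le_mul_of_nonneg_left hB hdn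
    nlinarith
  have e1 : (i : ℝ) * ((1 + d) ^ n / d) = (i : ℝ) * d * (1 + d) ^ n / d ^ 2 := by
    rw [pow_two, show (i : ℝ) * d * (1 + d) ^ n = d * ((i : ℝ) * (1 + d) ^ n) by ring,
      mul_div_mul_left _ _ hd.ne', mul_div_assoc]
  rw [e1, ← add_div, pow_add]
  exact div_le_div_of_nonneg_right (by linarith) hd2.le

/-- Term comparison of the proof of Theorem 4.15 (from `γ ≤ 1` and the exponent comparison):
`Θ^{n+i} γ^{((1+d)^{n+i}−1)/d²} ≤ Θⁿ γ^{((1+d)ⁿ−1)/d²} (Θ γ^{(1+d)ⁿ/d})^i`.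
[cite: EzquerrofernandezHernandezveron2017, §4.2.2 proof of Theorem 4.15 (p. 140)] -/
private theorem oneAux_term_le (hd : 0 < d) (hγ0 : 0 < γ) (hγ1 : γ ≤ 1) (hΘ0 : 0 ≤ Θ) (n i : ℕ) :
    Θ ^ (n + i) * γ ^ (((1 + d) ^ (n + i) - 1) / d ^ 2)
      ≤ Θ ^ n * γ ^ (((1 + d) ^ n - 1) / d ^ 2) * (Θ * γ ^ ((1 + d) ^ n / d)) ^ i := by
  have hγle : γ ^ (((1 + d) ^ (n + i) - 1) / d ^ 2)
      ≤ γ ^ (((1 + d) ^ n - 1) / d ^ 2 + (i : ℝ) * ((1 + d) ^ n / d)) :=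
    Real.rpow_le_rpow_of_exponent_ge hγ0 hγ1 (oneAux_exp_le hd n i)
  rw [Real.rpow_add hγ0, mul_comm (i : ℝ), Real.rpow_mul_natCast hγ0.le] at hγle
  rw [mul_pow, pow_add]
  calc Θ ^ n * Θ ^ i * γ ^ (((1 + d) ^ (n + i) - 1) / d ^ 2)
      ≤ Θ ^ n * Θ ^ i * (γ ^ (((1 + d) ^ n - 1) / d ^ 2) * (γ ^ ((1 + d) ^ n / d)) ^ i) :=
        mul_le_mul_of_nonneg_left hγle (by positivity)
    _ = Θ ^ n * γ ^ (((1 + d) ^ n - 1) / d ^ 2) * (Θ ^ i * (γ ^ ((1 + d) ^ n / d)) ^ i) := by ring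

/-- The ratio `Θ γ^{(1+d)ⁿ/d}` of the geometric sum in (4.16) lies in `[0, Θ] ⊂ [0, 1)` for
`0 ≤ Θ < 1`, `0 < γ ≤ 1`. [cite: EzquerrofernandezHernandezveron2017, §4.2.2 proof of Theorem 4.15 (p. 140)] -/
private theorem oneAux_rho (hd : 0 < d) (hγ0 : 0 < γ) (hγ1 : γ ≤ 1) (hΘ0 : 0 ≤ Θ) (hΘ1 : Θ < 1)
    (n : ℕ) : 0 ≤ Θ * γ ^ ((1 + d) ^ n / d) ∧ Θ * γ ^ ((1 + d) ^ n / d) ≤ Θ ∧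
      Θ * γ ^ ((1 + d) ^ n / d) < 1 := by
  have hg0 : 0 ≤ γ ^ ((1 + d) ^ n / d) := Real.rpow_nonneg hγ0.le _
  have hg1 : γ ^ ((1 + d) ^ n / d) ≤ 1 :=
    Real.rpow_le_one hγ0.le hγ1 (div_nonneg (pow_nonneg (by linarith) n) hd.le)
  have h2 : Θ * γ ^ ((1 + d) ^ n / d) ≤ Θ := by
    calc Θ * γ ^ ((1 + d) ^ n / d) ≤ Θ * 1 := mul_le_mul_of_nonneg_left hg1 hΘ0
      _ = Θ := mul_one Θ
  exact ⟨mul_nonneg hΘ0 hg0, h2, lt_of_le_of_lt h2 hΘ1⟩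

/-- **(4.16)** (proof of Theorem 4.15): if `‖x_{j+1} − xⱼ‖ ≤ η Θʲ γ^{((1+d)ʲ−1)/d²}` for all `j`
(`η ≥ 0`, `0 ≤ Θ < 1`, `0 < γ ≤ 1`, `d > 0`), then for all `n`, `m`,
`‖x_{n+m} − xₙ‖ ≤ η Θⁿ γ^{((1+d)ⁿ−1)/d²} (1 − (Θγ^{(1+d)ⁿ/d})^m)/(1 − Θγ^{(1+d)ⁿ/d})` (printed with `<`).
[cite: EzquerrofernandezHernandezveron2017, §4.2.2 Theorem 4.15, proof, (4.16) (p. 140)] -/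
theorem omegaNewtonErr_dist_le (hd : 0 < d) (hγ0 : 0 < γ) (hγ1 : γ ≤ 1) (hΘ0 : 0 ≤ Θ)
    (hΘ1 : Θ < 1) (hη : 0 ≤ η)
    (hstep : ∀ j, ‖x (j + 1) - x j‖ ≤ η * Θ ^ j * γ ^ (((1 + d) ^ j - 1) / d ^ 2)) (n m : ℕ) :
    ‖x (n + m) - x n‖ ≤ η * Θ ^ n * γ ^ (((1 + d) ^ n - 1) / d ^ 2) *
      ((1 - (Θ * γ ^ ((1 + d) ^ n / d)) ^ m) / (1 - Θ * γ ^ ((1 + d) ^ n / d))) := by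
  obtain ⟨hρ0, -, hρ1⟩ := oneAux_rho hd hγ0 hγ1 hΘ0 hΘ1 n
  have htel : ∀ m, ‖x (n + m) - x n‖ ≤ ∑ i ∈ Finset.range m, ‖x (n + i + 1) - x (n + i)‖ := by
    intro m
    induction m with
    | zero => simp
    | succ m ih =>
      rw [Finset.sum_range_succ]
      calc ‖x (n + (m + 1)) - x n‖ = ‖(x (n + m + 1) - x (n + m)) + (x (n + m) - x n)‖ := by
              rw [sub_add_sub_cancel, ← add_assoc]
        _ ≤ ‖x (n + m + 1) - x (n + m)‖ + ‖x (n + m) - x n‖ := norm_add_le _ _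
        _ ≤ (∑ i ∈ Finset.range m, ‖x (n + i + 1) - x (n + i)‖) + ‖x (n + m + 1) - x (n + m)‖ := by
              linarith [ih]
  have e : ((Θ * γ ^ ((1 + d) ^ n / d)) ^ m - 1) / (Θ * γ ^ ((1 + d) ^ n / d) - 1)
      = (1 - (Θ * γ ^ ((1 + d) ^ n / d)) ^ m) / (1 - Θ * γ ^ ((1 + d) ^ n / d)) := by
    rw [← neg_div_neg_eq, neg_sub, neg_sub]
  calc ‖x (n + m) - x n‖ ≤ ∑ i ∈ Finset.range m, ‖x (n + i + 1) - x (n + i)‖ := htel m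
    _ ≤ ∑ i ∈ Finset.range m,
          η * Θ ^ n * γ ^ (((1 + d) ^ n - 1) / d ^ 2) * (Θ * γ ^ ((1 + d) ^ n / d)) ^ i := by
        apply Finset.sum_le_sum
        intro i _
        calc ‖x (n + i + 1) - x (n + i)‖
            ≤ η * Θ ^ (n + i) * γ ^ (((1 + d) ^ (n + i) - 1) / d ^ 2) := hstep (n + i)
          _ = η * (Θ ^ (n + i) * γ ^ (((1 + d) ^ (n + i) - 1) / d ^ 2)) := by ring
          _ ≤ η * (Θ ^ n * γ ^ (((1 + d) ^ n - 1) / d ^ 2) * (Θ * γ ^ ((1 + d) ^ n / d)) ^ i) :=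
              mul_le_mul_of_nonneg_left (oneAux_term_le hd hγ0 hγ1 hΘ0 n i) hη
          _ = η * Θ ^ n * γ ^ (((1 + d) ^ n - 1) / d ^ 2) * (Θ * γ ^ ((1 + d) ^ n / d)) ^ i := by
              ring
    _ = η * Θ ^ n * γ ^ (((1 + d) ^ n - 1) / d ^ 2) *
          ∑ i ∈ Finset.range m, (Θ * γ ^ ((1 + d) ^ n / d)) ^ i := by rw [Finset.mul_sum]
    _ = η * Θ ^ n * γ ^ (((1 + d) ^ n - 1) / d ^ 2) *
          ((1 - (Θ * γ ^ ((1 + d) ^ n / d)) ^ m) / (1 - Θ * γ ^ ((1 + d) ^ n / d))) := by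
        rw [geom_sum_eq hρ1.ne m, e]

/-- Under the step bound of Theorem 4.15's proof (`0 ≤ Θ < 1`, `0 < γ ≤ 1`) the sequence is Cauchy
(the passage "letting `m → +∞` in (4.16)"): `‖x_{j+1} − xⱼ‖ ≤ η Θʲ`.
[cite: EzquerrofernandezHernandezveron2017, §4.2.2 Theorem 4.15, proof (p. 140)] -/
theorem omegaNewtonErr_cauchySeq (hd : 0 < d) (hγ0 : 0 < γ) (hγ1 : γ ≤ 1) (hΘ0 : 0 ≤ Θ)
    (hΘ1 : Θ < 1) (hη : 0 ≤ η)
    (hstep : ∀ j, ‖x (j + 1) - x j‖ ≤ η * Θ ^ j * γ ^ (((1 + d) ^ j - 1) / d ^ 2)) :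
    CauchySeq x := by
  refine cauchySeq_of_le_geometric Θ η hΘ1 fun j => ?_
  have hG : γ ^ (((1 + d) ^ j - 1) / d ^ 2) ≤ 1 :=
    Real.rpow_le_one hγ0.le hγ1
      (div_nonneg (sub_nonneg.2 (one_le_pow₀ (by linarith))) (sq_nonneg d))
  rw [dist_comm, dist_eq_norm]
  calc ‖x (j + 1) - x j‖ ≤ η * Θ ^ j * γ ^ (((1 + d) ^ j - 1) / d ^ 2) := hstep j
    _ ≤ η * Θ ^ j * 1 := mul_le_mul_of_nonneg_left hG (by positivity)
    _ = η * Θ ^ j := mul_one _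

/-- **Theorem 4.15, (4.15)** (a priori error estimate, operator-free form): under the step bound
`‖x_{j+1} − xⱼ‖ ≤ η Θʲ γ^{((1+d)ʲ−1)/d²}` (`η ≥ 0`, `0 ≤ Θ < 1`, `0 < γ ≤ 1`, `d > 0`), any limit `x*`
of the sequence satisfies `‖x* − xₙ‖ ≤ γ^{((1+d)ⁿ−1)/d²} Θⁿ η / (1 − γ^{(1+d)ⁿ/d} Θ)` for all `n ≥ 0`.
[cite: EzquerrofernandezHernandezveron2017, §4.2.2 Theorem 4.15, (4.15) with proof (p. 140)] -/
theorem omegaNewtonErr_apriori (hd : 0 < d) (hγ0 : 0 < γ) (hγ1 : γ ≤ 1) (hΘ0 : 0 ≤ Θ)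
    (hΘ1 : Θ < 1) (hη : 0 ≤ η)
    (hstep : ∀ j, ‖x (j + 1) - x j‖ ≤ η * Θ ^ j * γ ^ (((1 + d) ^ j - 1) / d ^ 2))
    {xstar : E} (hlim : Tendsto x atTop (𝓝 xstar)) (n : ℕ) :
    ‖xstar - x n‖ ≤
      η * Θ ^ n * γ ^ (((1 + d) ^ n - 1) / d ^ 2) / (1 - Θ * γ ^ ((1 + d) ^ n / d)) := by
  obtain ⟨hρ0, -, hρ1⟩ := oneAux_rho hd hγ0 hγ1 hΘ0 hΘ1 n
  have hK0 : 0 ≤ η * Θ ^ n * γ ^ (((1 + d) ^ n - 1) / d ^ 2) := by positivity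
  have h1ρ : 0 < 1 - Θ * γ ^ ((1 + d) ^ n / d) := by linarith
  have hbd : ∀ m, ‖x (n + m) - x n‖ ≤
      η * Θ ^ n * γ ^ (((1 + d) ^ n - 1) / d ^ 2) / (1 - Θ * γ ^ ((1 + d) ^ n / d)) := by
    intro m
    calc ‖x (n + m) - x n‖
        ≤ η * Θ ^ n * γ ^ (((1 + d) ^ n - 1) / d ^ 2) *
            ((1 - (Θ * γ ^ ((1 + d) ^ n / d)) ^ m) / (1 - Θ * γ ^ ((1 + d) ^ n / d))) :=
          omegaNewtonErr_dist_le hd hγ0 hγ1 hΘ0 hΘ1 hη hstep n m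
      _ ≤ η * Θ ^ n * γ ^ (((1 + d) ^ n - 1) / d ^ 2) * (1 / (1 - Θ * γ ^ ((1 + d) ^ n / d))) :=
          mul_le_mul_of_nonneg_left
            (div_le_div_of_nonneg_right (by linarith [pow_nonneg hρ0 m]) h1ρ.le) hK0
      _ = _ := (div_eq_mul_one_div _ _).symm
  have hlim' : Tendsto (fun m => x (n + m)) atTop (𝓝 xstar) :=
    hlim.comp (tendsto_atTop_atTop.2 fun b => ⟨b, fun m hm => hm.trans (Nat.le_add_left m n)⟩)
  have hnorm : Tendsto (fun m => ‖x (n + m) - x n‖) atTop (𝓝 ‖xstar - x n‖) :=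
    (hlim'.sub_const (x n)).norm
  exact le_of_tendsto' hnorm hbd

/-- **Theorem 4.15, R-order form**: from (4.15), `Θⁿ ≤ 1` and `γ^{(1+d)ⁿ/d} ≤ 1`,
`‖x* − xₙ‖ ≤ (η/(γ^{1/d²}(1 − Θ))) (γ^{1/d²})^{(1+d)ⁿ}` for all `n ≥ 0` — "the R-order of
convergence of the Newton sequence is therefore at least `1 + d`".
[cite: EzquerrofernandezHernandezveron2017, §4.2.2 Theorem 4.15, end of proof (p. 140)] -/
theorem omegaNewtonErr_rorder (hd : 0 < d) (hγ0 : 0 < γ) (hγ1 : γ ≤ 1) (hΘ0 : 0 ≤ Θ)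
    (hΘ1 : Θ < 1) (hη : 0 ≤ η)
    (hstep : ∀ j, ‖x (j + 1) - x j‖ ≤ η * Θ ^ j * γ ^ (((1 + d) ^ j - 1) / d ^ 2))
    {xstar : E} (hlim : Tendsto x atTop (𝓝 xstar)) (n : ℕ) :
    ‖xstar - x n‖ ≤ η / (γ ^ (1 / d ^ 2) * (1 - Θ)) * (γ ^ (1 / d ^ 2)) ^ ((1 + d) ^ n) := by
  have h := omegaNewtonErr_apriori hd hγ0 hγ1 hΘ0 hΘ1 hη hstep hlim n
  obtain ⟨-, hρle, -⟩ := oneAux_rho hd hγ0 hγ1 hΘ0 hΘ1 n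
  have hΘn : Θ ^ n ≤ 1 := pow_le_one₀ hΘ0 hΘ1.le
  have hγe : γ ^ (((1 + d) ^ n - 1) / d ^ 2) = (γ ^ (1 / d ^ 2)) ^ ((1 + d) ^ n) / γ ^ (1 / d ^ 2) := by
    rw [← Real.rpow_mul hγ0.le, one_div_mul_eq_div, sub_div, Real.rpow_sub hγ0]
  calc ‖xstar - x n‖
      ≤ η * Θ ^ n * γ ^ (((1 + d) ^ n - 1) / d ^ 2) / (1 - Θ * γ ^ ((1 + d) ^ n / d)) := h
    _ ≤ η * γ ^ (((1 + d) ^ n - 1) / d ^ 2) / (1 - Θ) := by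
        apply div_le_div₀ (by positivity) _ (by linarith) (by linarith)
        calc η * Θ ^ n * γ ^ (((1 + d) ^ n - 1) / d ^ 2)
            = Θ ^ n * (η * γ ^ (((1 + d) ^ n - 1) / d ^ 2)) := by ring
          _ ≤ 1 * (η * γ ^ (((1 + d) ^ n - 1) / d ^ 2)) :=
              mul_le_mul_of_nonneg_right hΘn (by positivity)
          _ = η * γ ^ (((1 + d) ^ n - 1) / d ^ 2) := one_mul _
    _ = η / (γ ^ (1 / d ^ 2) * (1 - Θ)) * (γ ^ (1 / d ^ 2)) ^ ((1 + d) ^ n) := by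
        rw [hγe, ← mul_div_assoc, div_div, div_mul_eq_mul_div]

/-- **Glue to Lemma 4.13 / Theorem 4.15**: a sequence with `‖x₁ − x₀‖ ≤ η` obeying the ratio
recursion (iiₙ) `‖x_{n+2} − x_{n+1}‖ ≤ (aₙ/(1 + d)) f(aₙ) ‖x_{n+1} − xₙ‖`, where `{aₙ}` satisfies the
conclusions of Lemmas 4.12 and 4.14 (b), obeys the step bounds `‖x_{k+1} − x_k‖ ≤ η Δ^k` (for (ivₙ))
and `‖x_{k+1} − x_k‖ ≤ η Θ^k γ^{((1+d)^k−1)/d²}` (for (4.15)–(4.16)).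
[cite: EzquerrofernandezHernandezveron2017, §4.2.2 Lemma 4.13 (iiₙ), (ivₙ), proof of Theorem 4.15 (pp. 139–140)] -/
theorem omegaNewtonErr_newton_step_le {a : ℕ → ℝ} (hd : 0 < d) (hγ0 : 0 < γ) (hΘ0 : 0 ≤ Θ)
    (hn0 : ∀ n, 0 ≤ a n) (hle0 : ∀ n, a n ≤ a 0) (ha01 : a 0 < 1)
    (hγ : ∀ n, a n ≤ γ ^ (((1 + d) ^ n - 1) / d) * a 0)
    (hΔ : Δ = a 0 * (1 / (1 - a 0)) / (1 + d)) (hΘ : Θ * γ ^ (1 / d) = Δ)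
    (hη0 : 0 ≤ η) (hη : ‖x 1 - x 0‖ ≤ η)
    (hrec : ∀ n, ‖x (n + 2) - x (n + 1)‖ ≤ a n * (1 / (1 - a n)) / (1 + d) * ‖x (n + 1) - x n‖)
    (k : ℕ) :
    ‖x (k + 1) - x k‖ ≤ η * Δ ^ k ∧
      ‖x (k + 1) - x k‖ ≤ η * Θ ^ k * γ ^ (((1 + d) ^ k - 1) / d ^ 2) := by
  have hP := omegaNewtonErr_step_le_prod hη (oneAux_factor_nonneg hd hn0 hle0 ha01) hrec k
  refine ⟨hP.trans (mul_le_mul_of_nonneg_left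
      (omegaNewtonErr_prod_le_delta hd hn0 hle0 ha01 hΔ k) hη0), ?_⟩
  rw [mul_assoc]
  exact hP.trans (mul_le_mul_of_nonneg_left
    (omegaNewtonErr_prod_le hd hγ0 hΘ0 hn0 hle0 ha01 hγ hΔ hΘ k) hη0)

-- Canary (planted FALSE sharpening, kept commented; uncommented in the probe copy it must FAIL):
-- example {E : Type*} [NormedAddCommGroup E] {x : ℕ → E} {η Δ : ℝ} (hη0 : 0 ≤ η) (hΔ0 : 0 ≤ Δ)
--     (hΔ1 : Δ < 1) (hstep : ∀ k, ‖x (k + 1) - x k‖ ≤ η * Δ ^ k) (n : ℕ) :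
--     ‖x (n + 1) - x 0‖ < η * (1 - Δ ^ (n + 1)) / (1 - Δ) := by
--   have := (omegaNewtonErr_dist_x0_le hη0 hΔ0 hΔ1 hstep n).1
--   linarith

end Normed

end Literature.Analysis.Calculus
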